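import Literature.Geometry.Kaehler.ComplexTorusPicardNumberOnePowersHodge
import Literature.Geometry.Kaehler.ComplexTorusPicardNumberOneThetaDivisor
import Literature.Geometry.Kaehler.ComplexTorusHodgeGroupSymplecticRealComplex
import Literature.Geometry.Kaehler.ComplexTorusPicardNumberProduct
import Literature.Geometry.Kaehler.ComplexTorusSimpleIsogenyInvariant
import Literature.Geometry.Kaehler.ComplexTorusProduct
import HarnessLib

/-!
# The Hodge conjecture for every power of the explicit abelian fivefold `X_2^L × X_3^L`
# (two Hodge-general factors of different dimensions: no exceptional classes)

Layer `Literature/Geometry/Kaehler`, namespace `Literature.Geometry.Kaehler.ComplexTorus`; lane `lit-hodgefound`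
(Track 2, Layer A4), seat `lit-hodgefound-skel-4`, row A4-122 of `run/shared/lean/pub/lit-hodgefound/SKELETON.md`.
THEOREMS ONLY (no `def`, no named fact, no instance, no notation; net debt `0`). Row A4-121 made the explicit
abelian surface `X_2^L` and threefold `X_3^L` (`End_ℚ = ℚ`, `Hg = Sp`) STABLY NONDEGENERATE. The tree's product
theorem for two stably nondegenerate polarised tori with `End_ℚ = ℚ`, symplectic Gram matrices `J` and DIFFERENT
dimensions (`IsRiemannForm.forall_divisorClasses_powPeriod_prod_eq_hodgeClasses_of_endAlgRat_eq_bot_of_card_ne`: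
`Hg(X₁ × X₂) = Hg(X₁) × Hg(X₂) = Sp × Sp`, Moonen–Zarhin (3.1), Gordon Thm. 7.5 / 7.6.2, Hazama, Murty) then gives:
**every power of the abelian fivefold `X_2^L × X_3^L` (in the Siegel presentations `x + iY_g^L y`) has all its
Hodge classes generated by divisor classes, `Dᵖ = Bᵖ`; every complex torus isogenous to such a power, presented
on an inner-product space, satisfies the Hodge `(p,p)`-conjecture in cycle form `Aᵖ = Bᵖ`; and
`ρ(X_2^L × X_3^L) = 2`, `dim_ℚ End_ℚ(X_2^L × X_3^L) = 2`.**

## Sources, verbatim (held copies)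

* B. Moonen, Yu. Zarhin, *Hodge classes on abelian varieties of low dimension*, Math. Ann. 315 (1999), §3 (3.1)–(3.2)
  [held arXiv:math/9901113 p0006 L52–L74]: "`Hg(X₁ × X₂) ≠ Hg(X₁) × Hg(X₂)` … holds if and only if for some `m` and `n`
  the Hodge ring `B•(X₁^m × X₂^n)` is not generated by the elements coming from `B•(X₁^m)` and `B•(X₂^n)`"; (3.2)
  Theorem (Hazama) (1): "Suppose `X₁` and `X₂` [both satisfying (D)] contain no factors of Type IV. Then `X₁ × X₂`
  again satisfies (D), and either `Hom(X₁, X₂) ≠ 0` or `Hg(X₁ × X₂) = Hg(X₁) × Hg(X₂)`."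
* B. B. Gordon, *A survey of the Hodge conjecture for abelian varieties* (1999), Thm. 7.5, Thm. 7.6.2 (Hazama, Murty:
  products of stably nondegenerate abelian varieties with `Hg(A × B) = Hg(A) × Hg(B)` are stably nondegenerate).
* H. Lange, *Abelian Varieties over the Complex Numbers* (2023): §7.3.1 Thm. 7.3.1 and Prop. 7.3.2 (the Hodge group
  of a product of general abelian varieties), p. 336 ("the Hodge `(p,p)`-conjecture is true if `Dᵖ = H^{2p}_Hodge`"),
  §7.3.3 Exercise (1)(b); §2.4.4 Cor. 2.4.26 (`Hom(X₁, X₂) = 0` for non-isogenous simple factors).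
* K. Hulek, R. Laface, *On the Picard numbers of abelian varieties* (2019), §2.1 Cor. 2.3
  (`ρ(X₁ × X₂) = ρ(X₁) + ρ(X₂) + rank Hom(X₁, X₂)`), §6.2 Prop. 6.4 (`X_g^L`).

## Contents

* §1 (the Siegel presentation `Φ(x, y) = x + iY_g^L y` of `X_g^L`, any `g ≥ 1`)
  `ratCast_map_J_eq_latticeGram_liouvillePolarization_of_forall_apply` (Gram matrix `J`),
  `isIsogenous_liouvillePeriod_of_forall_apply`, `forall_divisorClasses_powPeriod_eq_hodgeClasses_of_forall_apply_liouville`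
  (`g ∈ {2,3}`: `D = B` on all powers).
* §2 (the product) **`forall_divisorClasses_powPeriod_prod_liouville_eq_hodgeClasses`** (`g ≠ h` in `{2, 3}`:
  `Dᵖ((X_g^L × X_h^L)^k) = Bᵖ` for all `k, p`), `isAbelianVariety_powPeriod_prod_liouville`,
  **`IsIsogenous.forall_analyticClasses_eq_hodgeClasses_of_powPeriod_prod_liouville`** (cycle form for every
  inner-product torus isogenous to a power), **`IsIsogenous.analyticClasses_eq_hodgeClasses_of_prod_liouville`**
  (`k = 1`: THE HODGE CONJECTURE FOR EVERY TORUS ISOGENOUS TO THE FIVEFOLD `X_2^L × X_3^L`),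
  `IsIsogenous.forall_divisorClasses_eq_hodgeClasses_of_powPeriod_prod_liouville` (divisor form, any presentation).
* §3 (invariants) `homRat_liouville_eq_bot_of_ne`, **`finrank_neronSeveriGroup_prod_liouville`** (`ρ = 2`),
  **`finrank_endAlgRat_prod_liouville`** (`dim_ℚ End_ℚ = 2`).

## References

* [MoonenZarhin1999LowDim] B. J. J. Moonen, Yu. G. Zarhin, *Hodge classes on abelian varieties of low dimension*,
  Math. Ann. 315 (1999) 711–733, §2 (2.2), (2.3), §3 (3.1), (3.2) Theorem (Hazama).
* [Gordon1999HodgeAVSurvey] B. B. Gordon, *A survey of the Hodge conjecture for abelian varieties*, Appendix B in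
  J. D. Lewis, *A survey of the Hodge conjecture*, CRM Monograph Ser. 10 (1999), Thm. 7.5, Thm. 7.6.2.
* [Lange2023AbelianVarietiesComplex] H. Lange, *Abelian Varieties over the Complex Numbers*, Springer (2023), §7.3.1
  Thm. 7.3.1, Prop. 7.3.2 and p. 336, §7.3.3 Exercise (1)(b), §2.4.4 Cor. 2.4.26.
* [HulekLaface2019PicardNumbersAV] K. Hulek, R. Laface, *On the Picard numbers of abelian varieties*, Ann. Sc. Norm.
  Super. Pisa Cl. Sci. (5) XIX (2019) 1199–1224, §2.1 Cor. 2.3, §6.2 Prop. 6.4.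
-/

noncomputable section

open scoped Manifold ComplexOrder
open Module Matrix Set Function
open Complex (I ofReal)

universe u

namespace Literature.Geometry.Kaehler

namespace ComplexTorus

/-! ## §1 The Siegel presentation of `X_g^L`: Gram matrix `J`, `D = B` on all powers -/

section Siegel

variable {n : ℕ} (Φ : (Fin n ⊕ Fin n → ℝ) ≃L[ℝ] (Fin n → ℂ))
  (hΦ : ∀ v i, Φ v i = (v (Sum.inl i) : ℂ) + ∑ j, (I • (liouvillePeriodMatrix n).map ofReal) i j * (v (Sum.inr j) : ℂ))

/-- The standard symplectic matrix `J` over `ℚ`, cast to `ℝ`, is `J` over `ℝ` (private plumbing). [folklore] -/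
private theorem ratCast_map_J₁₂₂ (l : Type*) [DecidableEq l] :
    (Matrix.J l ℚ).map (Rat.cast : ℚ → ℝ) = Matrix.J l ℝ := by
  rw [Matrix.J, Matrix.J, Matrix.fromBlocks_map, Matrix.map_zero _ Rat.cast_zero,
    Matrix.map_neg _ Rat.cast_neg, Matrix.map_one _ Rat.cast_zero Rat.cast_one]

include hΦ in
/-- **The Gram matrix of `θ_L` on the lattice basis `(e, iY_g^L e)` of the Siegel presentation is the standard
symplectic matrix `J = (0 -1; 1 0)`** (a symplectic basis; Lange (3.1) with `D = 1`).
[cite: Lange2023AbelianVarietiesComplex, §3.1.1 Prop. 3.1.1 (3.1) (p0158)] -/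
theorem ratCast_map_J_eq_latticeGram_liouvillePolarization_of_forall_apply :
    (Matrix.J (Fin n) ℚ).map (Rat.cast : ℚ → ℝ) = latticeGram Φ (liouvillePolarization n) := by
  rw [ratCast_map_J₁₂₂, ← siegelTwoForm_one_eq_liouvillePolarization Φ hΦ, latticeGram_siegelTwoForm_one]

include hΦ in
/-- The Siegel presentation is isogenous (indeed isomorphic, row A4-118) to `X_g^L`.
[cite: Lange2023AbelianVarietiesComplex, §1.1.2 (1.2) and §3.1.1 Thm. 3.1.2] -/
theorem isIsogenous_liouvillePeriod_of_forall_apply : IsIsogenous Φ (liouvillePeriod n) :=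
  (isIsomorphic_liouvillePeriod_of_forall_apply Φ hΦ).isIsogenous

include hΦ in
/-- **`D = B` on every power of the Siegel presentation of `X_2^L`, `X_3^L`** (row A4-121 along the isomorphism).
[cite: MoonenZarhin1999LowDim, §2 (2.2), (2.3)] [cite: Gordon1999HodgeAVSurvey, Thm. 7.5] -/
theorem forall_divisorClasses_powPeriod_eq_hodgeClasses_of_forall_apply_liouville (h2 : 2 ≤ n) (h3 : n ≤ 3) :
    ∀ k p : ℕ, divisorClasses (powPeriod Φ k) p = hodgeClasses (powPeriod Φ k) p := by
  haveI : NeZero n := ⟨by omega⟩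
  exact (isIsogenous_liouvillePeriod_of_forall_apply Φ hΦ).forall_divisorClasses_powPeriod_eq_hodgeClasses_liouvillePeriod
    h2 h3

end Siegel

/-! ## §2 The product `X_g^L × X_h^L`, `g ≠ h` in `{2, 3}`: `D = B` on all powers, `A = B` up to isogeny -/

section Product

variable {n m : ℕ} (Φ₁ : (Fin n ⊕ Fin n → ℝ) ≃L[ℝ] (Fin n → ℂ)) (Φ₂ : (Fin m ⊕ Fin m → ℝ) ≃L[ℝ] (Fin m → ℂ))
  (hΦ₁ : ∀ v i, Φ₁ v i = (v (Sum.inl i) : ℂ) + ∑ j, (I • (liouvillePeriodMatrix n).map ofReal) i j * (v (Sum.inr j) : ℂ))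
  (hΦ₂ : ∀ v i, Φ₂ v i = (v (Sum.inl i) : ℂ) + ∑ j, (I • (liouvillePeriodMatrix m).map ofReal) i j * (v (Sum.inr j) : ℂ))

include hΦ₁ hΦ₂ in
/-- **EVERY POWER OF `X_g^L × X_h^L` (`g ≠ h` IN `{2, 3}`, I.E. OF THE ABELIAN FIVEFOLD `X_2^L × X_3^L`) HAS ALL ITS
HODGE CLASSES GENERATED BY DIVISOR CLASSES: `Dᵖ((X_g^L × X_h^L)^k) = Bᵖ` for all `k, p`** — both factors are
stably nondegenerate with `End_ℚ = ℚ` (row A4-121), their Gram matrices are `J`, and `dim X_g^L ≠ dim X_h^L`, so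
`Hg(X_g^L × X_h^L) = Sp_{2g} × Sp_{2h}` has no exceptional invariants (Moonen–Zarhin (3.1); Hazama–Murty, Gordon
Thm. 7.6.2). [cite: MoonenZarhin1999LowDim, §3 (3.1) and (3.2) Theorem (1) (Hazama; held arXiv:math/9901113 p0006 L52–L74)] [cite: Gordon1999HodgeAVSurvey, Thm. 7.5 and Thm. 7.6.2]
[cite: Lange2023AbelianVarietiesComplex, §7.3.1 Thm. 7.3.1 and Prop. 7.3.2] -/
theorem forall_divisorClasses_powPeriod_prod_liouville_eq_hodgeClasses (hn2 : 2 ≤ n) (hn3 : n ≤ 3) (hm2 : 2 ≤ m)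
    (hm3 : m ≤ 3) (hnm : n ≠ m) :
    ∀ k p : ℕ, divisorClasses (powPeriod (prodPeriod Φ₁ Φ₂) k) p = hodgeClasses (powPeriod (prodPeriod Φ₁ Φ₂) k) p := by
  haveI : NeZero n := ⟨by omega⟩
  haveI : NeZero m := ⟨by omega⟩
  haveI : Nonempty (Fin n) := ⟨⟨0, by omega⟩⟩
  haveI : Nonempty (Fin m) := ⟨⟨0, by omega⟩⟩
  have hX₁ := isIsogenous_liouvillePeriod_of_forall_apply Φ₁ hΦ₁
  have hX₂ := isIsogenous_liouvillePeriod_of_forall_apply Φ₂ hΦ₂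
  have hE₁ : endAlgRat Φ₁ = ⊥ :=
    Subalgebra.eq_bot_of_finrank_one (by rw [hX₁.finrank_endAlgRat_eq, finrank_endAlgRat_liouvillePeriod])
  have hE₂ : endAlgRat Φ₂ = ⊥ :=
    Subalgebra.eq_bot_of_finrank_one (by rw [hX₂.finrank_endAlgRat_eq, finrank_endAlgRat_liouvillePeriod])
  exact (isPrincipalPolarization_liouvillePolarization_of_forall_apply Φ₁ hΦ₁).isRiemannForm
    |>.forall_divisorClasses_powPeriod_prod_eq_hodgeClasses_of_endAlgRat_eq_bot_of_card_ne
    (isPrincipalPolarization_liouvillePolarization_of_forall_apply Φ₂ hΦ₂).isRiemannForm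
    (ratCast_map_J_eq_latticeGram_liouvillePolarization_of_forall_apply Φ₁ hΦ₁)
    (ratCast_map_J_eq_latticeGram_liouvillePolarization_of_forall_apply Φ₂ hΦ₂) hE₁ hE₂
    (forall_divisorClasses_powPeriod_eq_hodgeClasses_of_forall_apply_liouville Φ₁ hΦ₁ hn2 hn3)
    (forall_divisorClasses_powPeriod_eq_hodgeClasses_of_forall_apply_liouville Φ₂ hΦ₂ hm2 hm3)
    (by rwa [Fintype.card_fin, Fintype.card_fin])

include hΦ₁ hΦ₂ in
/-- The powers of `X_g^L × X_h^L` are abelian varieties. [cite: Lange2023AbelianVarietiesComplex, §2.1.1 Cor. 2.1.4] -/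
theorem isAbelianVariety_powPeriod_prod_liouville (k : ℕ) : IsAbelianVariety (powPeriod (prodPeriod Φ₁ Φ₂) k) :=
  (((isIsogenous_liouvillePeriod_of_forall_apply Φ₁ hΦ₁).isAbelianVariety_iff.2 (isAbelianVariety_liouvillePeriod n)).prod
    ((isIsogenous_liouvillePeriod_of_forall_apply Φ₂ hΦ₂).isAbelianVariety_iff.2 (isAbelianVariety_liouvillePeriod m))).pow k

variable {κ : Type*} [Fintype κ] [DecidableEq κ] {E' : Type u} [NormedAddCommGroup E'] [InnerProductSpace ℂ E']
  [FiniteDimensional ℂ E'] [MeasurableSpace E'] [BorelSpace E'] (Ψ : (κ → ℝ) ≃L[ℝ] E') {q : ℕ} (e : Fin q ≃ κ)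

include hΦ₁ hΦ₂ in
/-- **THE HODGE `(p,p)`-CONJECTURE IN CYCLE FORM FOR EVERY TORUS ISOGENOUS TO A POWER OF `X_2^L × X_3^L`**: if
`Y ∼ (X_g^L × X_h^L)^k` (`g ≠ h` in `{2,3}`), then `Aᵖ(Y) = Bᵖ(Y)` for every `p` — every rational `(p,p)`-class of
`Y` is a `ℚ`-combination of fundamental classes of closed analytic subsets.
[cite: Lange2023AbelianVarietiesComplex, §7.3.1 (p. 336) and §7.3.3 Exercise (1)(b)] [cite: MoonenZarhin1999LowDim, §3 (3.1) and Theorem]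
[cite: Gordon1999HodgeAVSurvey, Thm. 7.5 and Thm. 7.6.2] -/
theorem IsIsogenous.forall_analyticClasses_eq_hodgeClasses_of_powPeriod_prod_liouville {k : ℕ}
    (hY : IsIsogenous Ψ (powPeriod (prodPeriod Φ₁ Φ₂) k)) (hn2 : 2 ≤ n) (hn3 : n ≤ 3) (hm2 : 2 ≤ m) (hm3 : m ≤ 3)
    (hnm : n ≠ m) (p : ℕ) : analyticClasses Ψ e p = hodgeClasses Ψ p :=
  hY.forall_analyticClasses_eq_hodgeClasses_of_forall_divisorClasses_eq Ψ e _
    (isAbelianVariety_powPeriod_prod_liouville Φ₁ Φ₂ hΦ₁ hΦ₂ k)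
    (forall_divisorClasses_powPeriod_prod_liouville_eq_hodgeClasses Φ₁ Φ₂ hΦ₁ hΦ₂ hn2 hn3 hm2 hm3 hnm k) p

include hΦ₁ hΦ₂ in
/-- **In particular (the power `k = 1`): every complex torus isogenous to the abelian fivefold `X_2^L × X_3^L`,
presented on an inner-product space, satisfies the Hodge conjecture `Aᵖ = Bᵖ` in every codimension `p`.**
[cite: Lange2023AbelianVarietiesComplex, §7.3.1 Thm. 7.3.1 and p. 336] [cite: MoonenZarhin1999LowDim, §3 (3.1) and Theorem] -/
theorem IsIsogenous.analyticClasses_eq_hodgeClasses_of_prod_liouville (hY : IsIsogenous Ψ (prodPeriod Φ₁ Φ₂))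
    (hn2 : 2 ≤ n) (hn3 : n ≤ 3) (hm2 : 2 ≤ m) (hm3 : m ≤ 3) (hnm : n ≠ m) (p : ℕ) :
    analyticClasses Ψ e p = hodgeClasses Ψ p := by
  have hD := forall_divisorClasses_powPeriod_prod_liouville_eq_hodgeClasses Φ₁ Φ₂ hΦ₁ hΦ₂ hn2 hn3 hm2 hm3 hnm 1
  have hAV := isAbelianVariety_powPeriod_prod_liouville Φ₁ Φ₂ hΦ₁ hΦ₂ 1
  have h1 : IsIsogenous Ψ (powPeriod (prodPeriod Φ₁ Φ₂) 1) :=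
    IsIsogenous.trans _ _ _ hY (isIsomorphic_powPeriod_one (prodPeriod Φ₁ Φ₂)).isIsogenous
  exact h1.forall_analyticClasses_eq_hodgeClasses_of_forall_divisorClasses_eq Ψ e _ hAV hD p

omit [FiniteDimensional ℂ E'] [MeasurableSpace E'] [BorelSpace E'] in
include hΦ₁ hΦ₂ in
/-- **Divisor form, any presentation: every torus isogenous to a power of `X_2^L × X_3^L` has `Dᵖ = Bᵖ` for all `p`**
(`D = B` is an isogeny invariant). [cite: Lange2023AbelianVarietiesComplex, §7.3.3 Exercise (1)(b) (p. 341)]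
[cite: MoonenZarhin1999LowDim, §3 (3.1)] -/
theorem IsIsogenous.forall_divisorClasses_eq_hodgeClasses_of_powPeriod_prod_liouville
    {ι' : Type*} [Fintype ι'] [DecidableEq ι'] {F : Type*} [NormedAddCommGroup F] [NormedSpace ℂ F]
    (Ψ' : (ι' → ℝ) ≃L[ℝ] F) {k : ℕ} (hY : IsIsogenous Ψ' (powPeriod (prodPeriod Φ₁ Φ₂) k)) (hn2 : 2 ≤ n)
    (hn3 : n ≤ 3) (hm2 : 2 ≤ m) (hm3 : m ≤ 3) (hnm : n ≠ m) (p : ℕ) :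
    divisorClasses Ψ' p = hodgeClasses Ψ' p :=
  (hY.divisorClasses_eq_hodgeClasses_iff Ψ' _ p).2
    (forall_divisorClasses_powPeriod_prod_liouville_eq_hodgeClasses Φ₁ Φ₂ hΦ₁ hΦ₂ hn2 hn3 hm2 hm3 hnm k p)

end Product

/-! ## §3 Invariants of the product: `Hom = 0`, `ρ = 2`, `dim End_ℚ = 2` -/

section Invariants

variable {n m : ℕ} (Φ₁ : (Fin n ⊕ Fin n → ℝ) ≃L[ℝ] (Fin n → ℂ)) (Φ₂ : (Fin m ⊕ Fin m → ℝ) ≃L[ℝ] (Fin m → ℂ))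
  (hΦ₁ : ∀ v i, Φ₁ v i = (v (Sum.inl i) : ℂ) + ∑ j, (I • (liouvillePeriodMatrix n).map ofReal) i j * (v (Sum.inr j) : ℂ))
  (hΦ₂ : ∀ v i, Φ₂ v i = (v (Sum.inl i) : ℂ) + ∑ j, (I • (liouvillePeriodMatrix m).map ofReal) i j * (v (Sum.inr j) : ℂ))

include hΦ₁ hΦ₂ in
/-- **`Hom_ℚ(X_g^L, X_h^L) = 0` for `g ≠ h`**: both are simple (row A4-119 / `isSimple_liouvillePeriod`) of different
dimensions. [cite: Lange2023AbelianVarietiesComplex, §2.4.4 Cor. 2.4.26 (proof) and §1.1.2 Lemma 1.1.11] -/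
theorem homRat_liouville_eq_bot_of_ne (hnm : n ≠ m) : homRat Φ₁ Φ₂ = ⊥ :=
  ((isIsogenous_liouvillePeriod_of_forall_apply Φ₁ hΦ₁).isSimple_iff.2 (isSimple_liouvillePeriod n)).homRat_eq_bot_of_card_ne
    ((isIsogenous_liouvillePeriod_of_forall_apply Φ₂ hΦ₂).isSimple_iff.2 (isSimple_liouvillePeriod m))
    (by rwa [Fintype.card_sum, Fintype.card_fin, Fintype.card_sum, Fintype.card_fin, ← two_mul, ← two_mul,
      Ne, mul_right_inj' (two_ne_zero' ℕ)])

include hΦ₁ hΦ₂ in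
/-- **`ρ(X_g^L × X_h^L) = 2` for `g ≠ h` (`g, h ≥ 1`)**: `ρ(X₁ × X₂) = ρ(X₁) + ρ(X₂) + rank Hom(X₁, X₂) = 1 + 1 + 0`.
[cite: HulekLaface2019PicardNumbersAV, §2.1 Cor. 2.3 and §6.2 Prop. 6.4] -/
theorem finrank_neronSeveriGroup_prod_liouville [NeZero n] [NeZero m] (hnm : n ≠ m) :
    finrank ℤ (neronSeveriGroup (prodPeriod Φ₁ Φ₂)) = 2 := by
  have hX₁ := isIsogenous_liouvillePeriod_of_forall_apply Φ₁ hΦ₁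
  have hX₂ := isIsogenous_liouvillePeriod_of_forall_apply Φ₂ hΦ₂
  rw [(hX₁.isAbelianVariety_iff.2 (isAbelianVariety_liouvillePeriod n)).finrank_neronSeveriGroup_prod_of_homRat_eq_bot
    Φ₂ (homRat_liouville_eq_bot_of_ne Φ₂ Φ₁ hΦ₂ hΦ₁ (Ne.symm hnm)), hX₁.finrank_neronSeveriGroup_eq Φ₁ (liouvillePeriod n),
    hX₂.finrank_neronSeveriGroup_eq Φ₂ (liouvillePeriod m), finrank_neronSeveriGroup_liouvillePeriod,
    finrank_neronSeveriGroup_liouvillePeriod]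

include hΦ₁ hΦ₂ in
/-- **`dim_ℚ End_ℚ(X_g^L × X_h^L) = 2` for `g ≠ h`** (`End_ℚ = End_ℚ(X_g^L) × End_ℚ(X_h^L) = ℚ × ℚ`, the cross
`Hom`'s vanish). [cite: Lange2023AbelianVarietiesComplex, §2.4.4 Cor. 2.4.26] [cite: HulekLaface2019PicardNumbersAV, §6.1 Prop. 6.3 (proof)] -/
theorem finrank_endAlgRat_prod_liouville [NeZero n] [NeZero m] (hnm : n ≠ m) :
    finrank ℚ (endAlgRat (prodPeriod Φ₁ Φ₂)) = 2 := by
  rw [finrank_endAlgRat_prod Φ₁ Φ₂ (homRat_liouville_eq_bot_of_ne Φ₁ Φ₂ hΦ₁ hΦ₂ hnm)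
    (homRat_liouville_eq_bot_of_ne Φ₂ Φ₁ hΦ₂ hΦ₁ (Ne.symm hnm)),
    (isIsogenous_liouvillePeriod_of_forall_apply Φ₁ hΦ₁).finrank_endAlgRat_eq,
    (isIsogenous_liouvillePeriod_of_forall_apply Φ₂ hΦ₂).finrank_endAlgRat_eq, finrank_endAlgRat_liouvillePeriod,
    finrank_endAlgRat_liouvillePeriod]

end Invariants

end ComplexTorus

end Literature.Geometry.Kaehler

end
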